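import Summits.HodgeConjecture.HodgeConjecture.Theorems.Ring2AbelianAllAndreWeilFieldComponentCapstone
import Literature.AlgebraicGeometry.HodgeTheory.HyperplaneClassHardLefschetzPullback
import Literature.AlgebraicGeometry.HodgeTheory.HyperplaneClassRational
import Literature.AlgebraicGeometry.HodgeTheory.HypersurfaceLefschetzProofs
import Literature.AlgebraicGeometry.HodgeTheory.HyperplaneSectionMonodromySmoothLocus
import HarnessLib

/-!
# Ring 2 · AbelianAll — ANDRÉ AXIS, PART T-a: THE δ-COMPONENT ROWS WITH POSITIVITY — the restricted hyperplane class of the total space is a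
  POLARIZATION CLASS of every member, so every member of an anchored compact `E`-pencil is a literal instance of ALL FOUR binders of the
  cell's typed target `WeilClassesComponentCM R e₀ k δ` (Weil type, polarization class, Rosati, discriminant `δ`); the target CONSUMED on the
  pencil (target ⟹ the `E`-Weil classes of every member are algebraic, no `B⋆`), and the `B⋆`-row with the polarized component data
  (owed item (o158) of parts S-f / S-g; fact-free)

HONEST FRAMING (page 1, verbatim): **research route, not a corollary; conditional on HC_CM plus one named minimal statement.** Cell line:
research route conditional on HC_CM; not a corollary; Q11.4-sentence-2 already refuted in dim ≥ 3. Nothing in this file proves a case of the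
Hodge conjecture or of `B(X)` for a named `X`; `WeilClassesComponentCM R e₀ k δ` is proved for NO component (it enters §4 as a HYPOTHESIS, and its
members off the anchored pencils are untouched). `HC_CM`, `HC_AV`, the global nodes and Verdier's binder do NOT occur. Item
`Theses.RankFourFaces.CMToAbelian` (stmt-16267) stays OPEN; N104 untouched; no node is born (0 `def`, 0 `sorry`, no named fact). Seat
`pub-hodge-ring2-ab-andre-2`, gen 50 (part T).

Parts S-f / S-g (gen 49) showed that a compact `E`-pencil through a chart `E`-isogenous to a δ-anchor stays on the δ-component — every member
`(A_s, φ_s, e_s^*(H|X_s))` is `IsWeilTypeCM ∧ RosatiCompatible ∧ HasWeilDiscriminantCM δ` — "positivity apart": the fourth binder of the typed target,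
`IsPolarizationClass (A s).dim (A s).X (e_s^*(H|X_s))`, was not transported (it is not a topological invariant of the class). THIS FILE supplies it
in the form print uses (the relative hyperplane class of a projective total space polarises every member; the L-b pattern `exists_memberEmbedding`):

* §1 **`isPolarizationClass_map_of_isClosedImmersion`** (general smooth projective `X`): the pull-back `ι^*a` of ANY non-zero rational class `a` of
  `H²(ℙᴺ(ℂ); ℂ)` along a closed immersion `ι : X ↪ ℙᴺ` is a polarization class in dimension `dim X` (rational; supported on a divisor — classes
  restricted from projective space are algebraic, `map_projectiveSpace_mem_algebraicClasses`; hard Lefschetz — Voisin I Thm. 6.25 for the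
  hyperplane class, `hasHardLefschetzProperty_map_of_forall_eq_smul`, and `a = z·r₀`, `z ≠ 0`, `HasHardLefschetzProperty.smul`).
* §2 **`isPolarizationClass_memberClass`**: for a projective embedding `E : 𝒳 ↪ ℙᴺ` of the total space over a separated base, a rational ambient
  class `a ≠ 0` and a chart `e_s : A_s ≅ X_s` by an abelian variety, `e_s^*((E^*a)|X_s)` is a polarization class of `A_s` in dimension `dim A_s`
  (the composite `e_s ≫ ι_s ≫ E` is a closed immersion: complex points of a separated scheme are closed).
* §3 **`componentDataPolarized_member_of_isogenyPair_anchor`**: S-f's `componentData_member_of_isogenyPair_anchor` with the global class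
  `H = E^*a`: at EVERY member ALL FOUR binders of `WeilClassesComponentCM R e₀ k δ` hold for `(A_s, φ_s, e_s^*(H|X_s))`.
* §4 **`weilClassesField_le_algebraicClasses_forall_of_weilClassesComponentCM`** — THE TARGET CONSUMED ON THE PENCIL (no `B⋆`): granted
  `WeilClassesComponentCM R e₀ k δ`, all of `W_E(A_s, φ_s) ⊗ ℂ` is algebraic at EVERY member of such a pencil (the target gives the rational
  `(k,k)` classes; Moonen–Zarhin's one-class lemma `IsWeilTypeCM.weilClassesField_le_algebraicClasses_of_forall_isRationalClass` gives the rest).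
* §5 **`weilClassesField_le_algebraicClasses_and_componentDataPolarized_member_of_lefschetzB`** — the `B⋆`-row of S-f with the polarized
  component data; **`exists_componentAnchor_forall_pencil_componentDataPolarized`** — the S-g capstone (∃ anchor ∀ pencils) in polarized form;
  **`exists_componentAnchor_forall_pencil_of_weilClassesComponentCM`** — its target-consumed twin. So on every anchored pencil the SQUARE closes:
  `B⋆(𝒳) ∀η ⟹ [W_E(A_s) algebraic ∀ s] ⟸ WeilClassesComponentCM R e₀ k δ`, both at literal instances of the target's binders.

## Honest status

BOOKKEEPING (o158), fact-free; elementary given parts S-f / S-g and the tree's hyperplane-class theorems. Not constructed: the pencil, its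
`E`-action, the embedding whose restricted class at the chart is the anchor's class pulled back (`e_{s₀}^*(H|X_{s₀}) = u^*h₀` is a HYPOTHESIS on the
hypothetical pencil, as in S-g). The open input is `B⋆` of the one total space (§5) or the cell's typed target (§4), unchanged in strength; nothing
minimal claimed; N104 untouched. EDGE LABELS: all theorems K.
References: VoisinHodgeI2002 (Thm. 6.25, Thm. 7.10, §7.1.2, §11.1.2); VoisinHodgeII2003 (§1.2.3 Cor. 1.24, proof of Lemma 9.18); Hartshorne1977
(II Cor. 4.8, Ex. 3.11 (a)); Andre1996Motifs (§1.1 p. 10; §6.3 Lemme 6.3.3 and Remarque 2); Deligne1982HodgeCycles (§4 (4.4), p. 30 (1), Lemma 4.6,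
proof of Thm. 4.8, §5 (c)); MoonenZarhin1998WeilClasses (§1); Pohlmann1968 (Thm. 1); Andre2026 (§4.4.4).
-/

noncomputable section

set_option linter.dupNamespace false

namespace Summit.HodgeConjecture.HodgeConjecture.Ring2.AbelianAll

open CategoryTheory AlgebraicGeometry Polynomial NumberField
open Literature.AlgebraicGeometry Literature.AlgebraicGeometry.Motives
open Literature.AlgebraicGeometry.HodgeTheory Literature.AlgebraicGeometry.Deligne1982
open Literature.AlgebraicGeometry.Milne1999 (IsOfCMType)
open Literature.AlgebraicGeometry.Pohlmann1968 (IsNondegenerate)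
open Literature.Geometry.Kaehler (HasHardLefschetzProperty)
open Summit.HodgeConjecture.HodgeConjecture.Ring2.Hypotheses (RosatiCompatible WeilClassesComponentCM)

/-! ## §1 Restricted hyperplane classes are polarization classes (general smooth projective `X`) -/

section General

variable {X : SchemeOver ℂ} {n : ℕ}

/-- **The pull-back of a non-zero rational class of `H²(ℙᴺ(ℂ); ℂ)` along a closed immersion `ι : X ↪ ℙᴺ` of a smooth projective `X` of dimension
`n` is a polarization class in dimension `n`**: rational (`IsRationalClass.map`), supported on a divisor (`map_projectiveSpace_mem_algebraicClasses`),
and hard Lefschetz (`a = z • r₀` for the rational generator `r₀` with `z ≠ 0`; Voisin I Thm. 6.25 for `ι^* r₀` in the tree's form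
`hasHardLefschetzProperty_map_of_forall_eq_smul`; `HasHardLefschetzProperty.smul`). [cite: VoisinHodgeI2002, Thm. 6.25, Thm. 7.10 and §7.1.2]
[cite: VoisinHodgeII2003, §1.2.3 Cor. 1.24] [cite: Andre1996Motifs, §1.1 (p. 10)] -/
theorem isPolarizationClass_map_of_isClosedImmersion (hX : IsSmoothProjective n X) {N : ℕ} (ι : X ⟶ projectiveSpace N ℂ)
    [IsClosedImmersion ι.left] {a : complexBetti (projectiveSpace N ℂ) 2} (ha : IsRationalClass a) (ha0 : a ≠ 0) :
    IsPolarizationClass n X (complexBetti.map ι 2 a) := by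
  obtain ⟨r₀, -, hgen⟩ := exists_isRationalClass_forall_eq_smul_projectiveSpace N
  obtain ⟨z, hz⟩ := hgen a
  have hz0 : z ≠ 0 := by
    rintro rfl
    exact ha0 (by rw [hz, zero_smul])
  refine ⟨ha.map _, map_projectiveSpace_mem_algebraicClasses hX ι 1 a, ?_⟩
  have hL : HasHardLefschetzProperty (complexBetti.map ι 2 r₀) n := hasHardLefschetzProperty_map_of_forall_eq_smul hX ι hgen
  have heq : complexBetti.map ι 2 a = z • complexBetti.map ι 2 r₀ := by rw [hz, map_smul]
  rw [heq]
  exact HodgeTheory.HasHardLefschetzProperty.smul hL hz0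

end General

/-! ## §2 The restricted class of a projective embedding of the total space polarises every charted member -/

section Member

variable {𝒳 S : SchemeOver ℂ} {f : 𝒳 ⟶ S}

/-- **The restricted hyperplane class polarises the member.** For `S` separated over `ℂ`, a projective embedding `E : 𝒳 ↪ ℙᴺ` of the total space,
a rational ambient class `a ≠ 0`, and a chart `e : A ≅ X_s` of the member over the complex point `s` by an abelian variety: the class
`e^*((E^*a)|X_s)` is a polarization class of `A` in dimension `dim A` — it is the hyperplane-type class of the closed immersion `e ≫ ι_s ≫ E`
(`ι_s` is a closed immersion, complex points being closed; §1). [cite: VoisinHodgeI2002, Thm. 6.25 and §7.1.2] [cite: Hartshorne1977, II Ex. 3.11 (a) and Cor. II.4.8]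
[cite: Andre1996Motifs, §1.1 (p. 10)] -/
theorem isPolarizationClass_memberClass [IsSeparated S.hom] (E : ProjectiveEmbedding 𝒳) {a : complexBetti (projectiveSpace E.n ℂ) 2}
    (ha : IsRationalClass a) (ha0 : a ≠ 0) {s : ComplexPoints S} {A : AbelianVariety ℂ} (e : A.X ≅ fiberOver f s) :
    IsPolarizationClass A.dim A.X (complexBetti.map e.hom 2 (complexBetti.map (fiberι f s) 2 (complexBetti.map E.ι 2 a))) := by
  haveI : IsClosedImmersion (fiberι f s).left := HodgeTheory.isClosedImmersion_fiberι_left f s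
  haveI : IsClosedImmersion (e.hom ≫ fiberι f s ≫ E.ι).left := by
    rw [Over.comp_left, Over.comp_left]; infer_instance
  have h := isPolarizationClass_map_of_isClosedImmersion (Motives.AbelianVariety.isSmoothProjective_holds (A := A))
    (e.hom ≫ fiberι f s ≫ E.ι) ha ha0
  simpa only [complexBetti.map_comp, ModuleCat.comp_apply] using h

/-- The same for a compact abelian pencil, whose base (a smooth projective curve) is separated. [cite: Andre1996Motifs, §1.1 (p. 10) and §6.3]
[cite: VoisinHodgeI2002, Thm. 6.25 and §7.1.2] -/
theorem isPolarizationClass_memberClass_of_pencil {d : ℕ} (hf : IsCompactAbelianPencil f d) (E : ProjectiveEmbedding 𝒳)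
    {a : complexBetti (projectiveSpace E.n ℂ) 2} (ha : IsRationalClass a) (ha0 : a ≠ 0) {s : ComplexPoints S} {A : AbelianVariety ℂ}
    (e : A.X ≅ fiberOver f s) :
    IsPolarizationClass A.dim A.X (complexBetti.map e.hom 2 (complexBetti.map (fiberι f s) 2 (complexBetti.map E.ι 2 a))) := by
  haveI : IsProper S.hom := IsSmoothProjective.isProper_holds hf.isSmoothProjective_base
  exact isPolarizationClass_memberClass E ha ha0 e

end Member

/-! ## §3 The polarized component data at every member -/

section Pencil

variable {𝒳 S : SchemeOver ℂ} {f : 𝒳 ⟶ S} {d : ℕ} {R : Polynomial ℤ} [Fact (Irreducible (realPolyQ R))] {e₀ k : ℕ}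

/-- **ALL FOUR BINDERS OF THE TYPED TARGET AT EVERY MEMBER.** Setting of part S-f's `componentData_member_of_isogenyPair_anchor` on a compact abelian
pencil `f : 𝒳 ⟶ S` with a global endomorphism `Φ` over `S`, `Φ`-compatible charts `(A_s, e_s, φ_s)` with `R(φ_s²) = 0`, a rational global `U` on
`W_E(A_t) ⊗ ℂ` with `U|X_t ≠ 0`, an anchor `(A₀, η₀, h₀)` of Weil type relative to `E`, Rosati-compatible, of discriminant `δ`, an `E`-isogeny pair at
ONE chart `A_{s₀}`, and the global class now THE RESTRICTED CLASS OF A PROJECTIVE EMBEDDING of the total space, `H = E^*a` (`a` rational, `≠ 0`), with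
`e_{s₀}^*(H|X_{s₀}) = u^*h₀`. Then at EVERY member `s`: `(A_s, φ_s)` is of Weil type relative to `E`, `e_s^*(H|X_s)` is a POLARIZATION CLASS of `A_s`,
Rosati-compatible, of discriminant `δ` — the four hypotheses of `Ring2.Hypotheses.WeilClassesComponentCM R e₀ k δ` at `(A_s, φ_s, e_s^*(H|X_s))`.
[cite: Deligne1982HodgeCycles, §4 (4.4), p. 30 (1), Lemma 4.6, Remark 4.10 and proof of Thm. 4.8] [cite: MoonenZarhin1998WeilClasses, §1 (Criterion)]
[cite: VoisinHodgeI2002, Thm. 6.25 and §7.1.2] [cite: Andre1996Motifs, §6.3 Lemme 6.3.3 and Remarque 2 (p. 33)] -/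
theorem componentDataPolarized_member_of_isogenyPair_anchor (hf : IsCompactAbelianPencil f d)
    (Φ : 𝒳 ⟶ 𝒳) (hΦ : Φ ≫ f = f) (E : ProjectiveEmbedding 𝒳) {a : complexBetti (projectiveSpace E.n ℂ) 2}
    (ha : IsRationalClass a) (ha0 : a ≠ 0)
    (A : ComplexPoints S → AbelianVariety ℂ) (e : ∀ s, (A s).X ≅ fiberOver f s) (φ : ∀ s, A s ⟶ A s)
    (hK : ∀ s, ∃ Φs : fiberOver f s ⟶ fiberOver f s, Φs ≫ fiberι f s = fiberι f s ≫ Φ ∧ (e s).hom ≫ Φs = (φ s).hom.hom.hom ≫ (e s).hom)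
    (hP : ∀ s, Polynomial.eval₂ (Int.castRingHom (CategoryTheory.End (A s))) ((φ s : CategoryTheory.End (A s)))
      (R.comp (X ^ 2)) = 0)
    (U : complexBetti 𝒳 (2 * k)) (hUQ : IsRationalClass U) {t : ComplexPoints S}
    (hUt : complexBetti.map (e t).hom (2 * k) (complexBetti.map (fiberι f t) (2 * k) U) ∈
      weilClassesField (A t) (φ t) (R.comp (X ^ 2)) (2 * k))
    (hU0 : complexBetti.map (fiberι f t) (2 * k) U ≠ 0)
    {A₀ : AbelianVariety ℂ} {η₀ : A₀ ⟶ A₀} {h₀ : complexBetti A₀.X 2} {δ : cmNormResidueGroup R}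
    (hW₀ : IsWeilTypeCM A₀ η₀ R e₀ k) (hros₀ : RosatiCompatible A₀ η₀ h₀) (hdisc₀ : HasWeilDiscriminantCM A₀ η₀ R e₀ k h₀ δ)
    {s₀ : ComplexPoints S} (hdim : (A s₀).dim = A₀.dim) (u : A s₀ ⟶ A₀) (v : A₀ ⟶ A s₀) {n n' : ℕ} (hn : 0 < n) (hn' : 0 < n')
    (hvu : v ≫ u = n • 𝟙 A₀) (huv : u ≫ v = n' • 𝟙 (A s₀)) (hu : u ≫ η₀ = φ s₀ ≫ u)
    (hH₀ : complexBetti.map (e s₀).hom 2 (complexBetti.map (fiberι f s₀) 2 (complexBetti.map E.ι 2 a)) =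
      complexBetti.map u.hom.hom.hom 2 h₀) (s : ComplexPoints S) :
    IsWeilTypeCM (A s) (φ s) R e₀ k ∧
      IsPolarizationClass (A s).dim (A s).X (complexBetti.map (e s).hom 2 (complexBetti.map (fiberι f s) 2 (complexBetti.map E.ι 2 a))) ∧
      RosatiCompatible (A s) (φ s) (complexBetti.map (e s).hom 2 (complexBetti.map (fiberι f s) 2 (complexBetti.map E.ι 2 a))) ∧
      HasWeilDiscriminantCM (A s) (φ s) R e₀ k
        (complexBetti.map (e s).hom 2 (complexBetti.map (fiberι f s) 2 (complexBetti.map E.ι 2 a))) δ := by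
  obtain ⟨hW, hros, hdisc⟩ := componentData_member_of_isogenyPair_anchor hf Φ hΦ (complexBetti.map E.ι 2 a) A e φ hK hP U hUQ hUt hU0
    hW₀ hros₀ hdisc₀ hdim u v hn hn' hvu huv hu hH₀ s
  exact ⟨hW, isPolarizationClass_memberClass_of_pencil hf E ha ha0 (e s), hros, hdisc⟩

/-! ## §4 The typed target consumed on the pencil (no `B⋆`) -/

/-- **THE CELL'S TYPED TARGET CONSUMED ON THE PENCIL.** In the setting of `componentDataPolarized_member_of_isogenyPair_anchor` (no `B⋆`, no Hodge
conjecture anywhere), GRANTED `WeilClassesComponentCM R e₀ k δ` — the class target of the component `(E, 2k, δ)`, OPEN, a HYPOTHESIS here — ALL of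
`W_E(A_s, φ_s) ⊗ ℂ` is algebraic at EVERY member `s`: each member is a literal instance of the target's four binders (§3), so its rational `(k,k)`
`E`-Weil classes are algebraic, and the one-class lemma (`dim_E W_E = 1`, Moonen–Zarhin) gives the whole of `W_E ⊗ ℂ`
(`IsWeilTypeCM.weilClassesField_le_algebraicClasses_of_forall_isRationalClass`). The converse bookkeeping of part S-f's `B⋆`-row: on these pencils the
conclusion «`W_E` of every member algebraic» follows from EITHER `B⋆` of the one total space OR the cell's typed target. Neither hypothesis is claimed.
[cite: Deligne1982HodgeCycles, §4 (4.4), p. 30 (1), Prop. 4.1, Lemma 4.6] [cite: MoonenZarhin1998WeilClasses, §1 (dim_F W_F = 1; «all or nothing»)]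
[cite: Andre2026, §4.4.4] -/
theorem weilClassesField_le_algebraicClasses_forall_of_weilClassesComponentCM (hf : IsCompactAbelianPencil f d)
    {δ : cmNormResidueGroup R} (hcell : WeilClassesComponentCM R e₀ k δ)
    (Φ : 𝒳 ⟶ 𝒳) (hΦ : Φ ≫ f = f) (E : ProjectiveEmbedding 𝒳) {a : complexBetti (projectiveSpace E.n ℂ) 2}
    (ha : IsRationalClass a) (ha0 : a ≠ 0)
    (A : ComplexPoints S → AbelianVariety ℂ) (e : ∀ s, (A s).X ≅ fiberOver f s) (φ : ∀ s, A s ⟶ A s)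
    (hK : ∀ s, ∃ Φs : fiberOver f s ⟶ fiberOver f s, Φs ≫ fiberι f s = fiberι f s ≫ Φ ∧ (e s).hom ≫ Φs = (φ s).hom.hom.hom ≫ (e s).hom)
    (hP : ∀ s, Polynomial.eval₂ (Int.castRingHom (CategoryTheory.End (A s))) ((φ s : CategoryTheory.End (A s)))
      (R.comp (X ^ 2)) = 0)
    (U : complexBetti 𝒳 (2 * k)) (hUQ : IsRationalClass U) {t : ComplexPoints S}
    (hUt : complexBetti.map (e t).hom (2 * k) (complexBetti.map (fiberι f t) (2 * k) U) ∈
      weilClassesField (A t) (φ t) (R.comp (X ^ 2)) (2 * k))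
    (hU0 : complexBetti.map (fiberι f t) (2 * k) U ≠ 0)
    {A₀ : AbelianVariety ℂ} {η₀ : A₀ ⟶ A₀} {h₀ : complexBetti A₀.X 2}
    (hW₀ : IsWeilTypeCM A₀ η₀ R e₀ k) (hros₀ : RosatiCompatible A₀ η₀ h₀) (hdisc₀ : HasWeilDiscriminantCM A₀ η₀ R e₀ k h₀ δ)
    {s₀ : ComplexPoints S} (hdim : (A s₀).dim = A₀.dim) (u : A s₀ ⟶ A₀) (v : A₀ ⟶ A s₀) {n n' : ℕ} (hn : 0 < n) (hn' : 0 < n')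
    (hvu : v ≫ u = n • 𝟙 A₀) (huv : u ≫ v = n' • 𝟙 (A s₀)) (hu : u ≫ η₀ = φ s₀ ≫ u)
    (hH₀ : complexBetti.map (e s₀).hom 2 (complexBetti.map (fiberι f s₀) 2 (complexBetti.map E.ι 2 a)) =
      complexBetti.map u.hom.hom.hom 2 h₀) (s : ComplexPoints S) :
    weilClassesField (A s) (φ s) (R.comp (X ^ 2)) (2 * k) ≤ algebraicClasses (A s).X k := by
  obtain ⟨hW, hpol, hros, hdisc⟩ := componentDataPolarized_member_of_isogenyPair_anchor hf Φ hΦ E ha ha0 A e φ hK hP U hUQ hUt hU0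
    hW₀ hros₀ hdisc₀ hdim u v hn hn' hvu huv hu hH₀ s
  exact hW.weilClassesField_le_algebraicClasses_of_forall_isRationalClass fun c hc hcQ ↦
    hcell (A s) (φ s) _ hW hpol hros hdisc c hc hcQ (hW.isOfHodgeType_of_mem_weilClassesField' hc)

/-! ## §5 The `B⋆`-row with the polarized component data; the ∃∀ capstones -/

/-- **WITH `B⋆` OF THE ONE TOTAL SPACE: THE FOUR BINDERS AND THE CONCLUSION OF THE TYPED TARGET AT EVERY MEMBER.** Part S-f's
`weilClassesField_le_algebraicClasses_and_componentData_member_of_lefschetzB` with the global class the restricted class of a projective embedding of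
`𝒳`: on a compact pencil of abelian `2ke₀`-folds with `B⋆(𝒳, η)` for every `η`, through a chart `E`-isogenous (both intertwinings, both composites) to
an anchor with algebraic `W_E`, at EVERY member `(A_s, φ_s, e_s^*(H|X_s))` is of Weil type relative to `E`, POLARIZED, Rosati-compatible, of
discriminant `δ`, AND `W_E(A_s, φ_s) ⊗ ℂ ⊆ Nᵏ(A_s)` (fact-free). [cite: Deligne1982HodgeCycles, §4 (4.4), Lemma 4.6, Remark 4.10 and proof of Thm. 4.8]
[cite: MoonenZarhin1998WeilClasses, §1 (dim_F W_F = 1; Criterion)] [cite: VoisinHodgeI2002, Thm. 6.25 and §7.1.2]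
[cite: Andre1996Motifs, §6.3 Lemme 6.3.3 and Remarque 2 (p. 33)] [cite: Andre2026, §4.4.4] -/
theorem weilClassesField_le_algebraicClasses_and_componentDataPolarized_member_of_lefschetzB
    (hf : IsCompactAbelianPencil f (2 * k * e₀)) (hB : ∀ ηX : complexBetti 𝒳 2, StandardConjectureBStar (2 * k * e₀ + 1) 𝒳 ηX)
    (Φ : 𝒳 ⟶ 𝒳) (hΦ : Φ ≫ f = f) (E : ProjectiveEmbedding 𝒳) {a : complexBetti (projectiveSpace E.n ℂ) 2}
    (ha : IsRationalClass a) (ha0 : a ≠ 0)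
    (A : ComplexPoints S → AbelianVariety ℂ) (e : ∀ s, (A s).X ≅ fiberOver f s) (φ : ∀ s, A s ⟶ A s)
    (hK : ∀ s, ∃ Φs : fiberOver f s ⟶ fiberOver f s, Φs ≫ fiberι f s = fiberι f s ≫ Φ ∧ (e s).hom ≫ Φs = (φ s).hom.hom.hom ≫ (e s).hom)
    (hP : ∀ s, Polynomial.eval₂ (Int.castRingHom (CategoryTheory.End (A s))) ((φ s : CategoryTheory.End (A s)))
      (R.comp (X ^ 2)) = 0)
    (U : complexBetti 𝒳 (2 * k)) (hUQ : IsRationalClass U) {t : ComplexPoints S}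
    (hUt : complexBetti.map (e t).hom (2 * k) (complexBetti.map (fiberι f t) (2 * k) U) ∈
      weilClassesField (A t) (φ t) (R.comp (X ^ 2)) (2 * k))
    (hU0 : complexBetti.map (fiberι f t) (2 * k) U ≠ 0)
    {A₀ : AbelianVariety ℂ} {η₀ : A₀ ⟶ A₀} {h₀ : complexBetti A₀.X 2} {δ : cmNormResidueGroup R}
    (hW₀ : IsWeilTypeCM A₀ η₀ R e₀ k) (hros₀ : RosatiCompatible A₀ η₀ h₀) (hdisc₀ : HasWeilDiscriminantCM A₀ η₀ R e₀ k h₀ δ)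
    (halg₀ : weilClassesField A₀ η₀ (R.comp (X ^ 2)) (2 * k) ≤ algebraicClasses A₀.X k)
    {s₀ : ComplexPoints S} (hdim : (A s₀).dim = A₀.dim) (u : A s₀ ⟶ A₀) (v : A₀ ⟶ A s₀) {n n' : ℕ} (hn : 0 < n) (hn' : 0 < n')
    (hvu : v ≫ u = n • 𝟙 A₀) (huv : u ≫ v = n' • 𝟙 (A s₀)) (hu : u ≫ η₀ = φ s₀ ≫ u) (hv : v ≫ φ s₀ = η₀ ≫ v)
    (hH₀ : complexBetti.map (e s₀).hom 2 (complexBetti.map (fiberι f s₀) 2 (complexBetti.map E.ι 2 a)) =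
      complexBetti.map u.hom.hom.hom 2 h₀) (s : ComplexPoints S) :
    (IsWeilTypeCM (A s) (φ s) R e₀ k ∧
      IsPolarizationClass (A s).dim (A s).X (complexBetti.map (e s).hom 2 (complexBetti.map (fiberι f s) 2 (complexBetti.map E.ι 2 a))) ∧
      RosatiCompatible (A s) (φ s) (complexBetti.map (e s).hom 2 (complexBetti.map (fiberι f s) 2 (complexBetti.map E.ι 2 a))) ∧
      HasWeilDiscriminantCM (A s) (φ s) R e₀ k
        (complexBetti.map (e s).hom 2 (complexBetti.map (fiberι f s) 2 (complexBetti.map E.ι 2 a))) δ) ∧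
      weilClassesField (A s) (φ s) (R.comp (X ^ 2)) (2 * k) ≤ algebraicClasses (A s).X k := by
  obtain ⟨⟨hW, hros, hdisc⟩, halg⟩ := weilClassesField_le_algebraicClasses_and_componentData_member_of_lefschetzB hf hB Φ hΦ
    (complexBetti.map E.ι 2 a) A e φ hK hP U hUQ hUt hU0 hW₀ hros₀ hdisc₀ halg₀ hdim u v hn hn' hvu huv hu hv hH₀ s
  exact ⟨⟨hW, isPolarizationClass_memberClass_of_pencil hf E ha ha0 (e s), hros, hdisc⟩, halg⟩

open Summit.HodgeConjecture.HodgeConjecture.Ring2.WeilCoverageCM (exists_cmMember_hodgeConjectureFor_of_exists_isNondegenerate)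

variable (K : Type) [Field K] [NumberField K] [IsCMField K]

/-- **THE δ-COMPONENT CAPSTONE, POLARIZED (∃ anchor ∀ pencils; fact-free).** Part S-g's `exists_componentAnchor_forall_pencil_componentData` with the
global class the restricted class `E^*a` of a projective embedding of the total space: `K` a CM field of degree `2e₀ > 2` with a NONDEGENERATE CM type
and Deligne's presentation `(b₀, R)`, `p ≥ 1`, ANY `δ ∈ E⁺ˣ/N(Eˣ)` ⟹ there is an anchor `(A₀, η₀, h₀)` (ring2-b03's CM power member: CM type, Weil type,
polarization class, Rosati, discriminant `δ`, Hodge conjecture, algebraic `W_E`) such that for EVERY compact pencil of abelian `2pe₀`-folds with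
`B⋆(𝒳, η) ∀η`, a global `E`-action with compatible charts, a rational global `U` on `W_E(A_t) ⊗ ℂ` non-zero at `t`, a projective embedding `E` of `𝒳`
with rational ambient class `a ≠ 0`, and at ONE chart an `E`-isogeny pair with the anchor under which `e_{s₀}^*((E^*a)|X_{s₀}) = u^*h₀`: at EVERY
member, `(A_s, φ_s, e_s^*((E^*a)|X_s))` satisfies ALL FOUR binders of `WeilClassesComponentCM R e₀ p δ` AND all of `W_E(A_s, φ_s) ⊗ ℂ` is algebraic.
[cite: Deligne1982HodgeCycles, §4 (4.4), Lemma 4.6, Remark 4.10, proof of Thm. 4.8 and §5 (c) pp. 38–39] [cite: Pohlmann1968, Thm. 1]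
[cite: Andre1996Motifs, §6.3 Lemme 6.3.3 and Remarque 2 (p. 33)] [cite: MoonenZarhin1998WeilClasses, §1] [cite: VoisinHodgeI2002, Thm. 6.25 and §7.1.2]
[cite: Andre2026, §4.4.4] -/
theorem exists_componentAnchor_forall_pencil_componentDataPolarized (hK : 2 < Module.finrank ℚ K)
    {b₀ : 𝓞 K} (hb₀ : IsCMField.complexConj K (b₀ : K) = -(b₀ : K))
    (hsep : Function.Injective fun σ : K →+* ℂ => σ (b₀ : K))
    {R : Polynomial ℤ} {e₀ : ℕ} (he : Module.finrank ℚ K = 2 * e₀) (hRm : R.Monic) (hRdeg : R.natDegree = e₀)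
    (hR : R.comp (X ^ 2) = minpoly ℤ b₀) (hirr : Irreducible (cmPolyQ R))
    (hroots : ∀ s : ℂ, Polynomial.eval₂ (Int.castRingHom ℂ) s R = 0 → s.im = 0 ∧ s.re < 0)
    (haev : Polynomial.aeval (b₀ : K) (cmPolyQ R) = 0) (hdegQ : (cmPolyQ R).natDegree = Module.finrank ℚ K)
    [Fact (Irreducible (realPolyQ R))] (hnd : ∃ Ψ : CMType K, IsNondegenerate Ψ) {p : ℕ} (hp : 0 < p)
    (δ : cmNormResidueGroup R) :
    ∃ (A₀ : AbelianVariety ℂ) (η₀ : A₀ ⟶ A₀) (h₀ : complexBetti A₀.X 2),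
      (IsOfCMType A₀ ∧ IsWeilTypeCM A₀ η₀ R e₀ p ∧ IsPolarizationClass A₀.dim A₀.X h₀ ∧ RosatiCompatible A₀ η₀ h₀ ∧
        HasWeilDiscriminantCM A₀ η₀ R e₀ p h₀ δ ∧ HodgeConjectureFor A₀.dim A₀.X ∧
        weilClassesField A₀ η₀ (R.comp (X ^ 2)) (2 * p) ≤ algebraicClasses A₀.X p) ∧
      ∀ {𝒳 S : SchemeOver ℂ} {f : 𝒳 ⟶ S} (_hf : IsCompactAbelianPencil f (2 * p * e₀))
        (_hB : ∀ ηX : complexBetti 𝒳 2, StandardConjectureBStar (2 * p * e₀ + 1) 𝒳 ηX)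
        (Φ : 𝒳 ⟶ 𝒳) (_hΦ : Φ ≫ f = f) (E : ProjectiveEmbedding 𝒳) (a : complexBetti (projectiveSpace E.n ℂ) 2)
        (_ha : IsRationalClass a) (_ha0 : a ≠ 0)
        (A : ComplexPoints S → AbelianVariety ℂ) (e : ∀ s, (A s).X ≅ fiberOver f s) (φ : ∀ s, A s ⟶ A s)
        (_hK : ∀ s, ∃ Φs : fiberOver f s ⟶ fiberOver f s,
          Φs ≫ fiberι f s = fiberι f s ≫ Φ ∧ (e s).hom ≫ Φs = (φ s).hom.hom.hom ≫ (e s).hom)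
        (_hP : ∀ s, Polynomial.eval₂ (Int.castRingHom (CategoryTheory.End (A s))) ((φ s : CategoryTheory.End (A s)))
          (R.comp (X ^ 2)) = 0)
        (U : complexBetti 𝒳 (2 * p)) (_hUQ : IsRationalClass U) {t : ComplexPoints S}
        (_hUt : complexBetti.map (e t).hom (2 * p) (complexBetti.map (fiberι f t) (2 * p) U) ∈
          weilClassesField (A t) (φ t) (R.comp (X ^ 2)) (2 * p))
        (_hU0 : complexBetti.map (fiberι f t) (2 * p) U ≠ 0)
        {s₀ : ComplexPoints S} (_hdim : (A s₀).dim = A₀.dim) (u : A s₀ ⟶ A₀) (v : A₀ ⟶ A s₀) {n n' : ℕ} (_hn : 0 < n) (_hn' : 0 < n')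
        (_hvu : v ≫ u = n • 𝟙 A₀) (_huv : u ≫ v = n' • 𝟙 (A s₀)) (_hu : u ≫ η₀ = φ s₀ ≫ u) (_hv : v ≫ φ s₀ = η₀ ≫ v)
        (_hH₀ : complexBetti.map (e s₀).hom 2 (complexBetti.map (fiberι f s₀) 2 (complexBetti.map E.ι 2 a)) =
          complexBetti.map u.hom.hom.hom 2 h₀)
        (s : ComplexPoints S),
        (IsWeilTypeCM (A s) (φ s) R e₀ p ∧
          IsPolarizationClass (A s).dim (A s).X
            (complexBetti.map (e s).hom 2 (complexBetti.map (fiberι f s) 2 (complexBetti.map E.ι 2 a))) ∧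
          RosatiCompatible (A s) (φ s) (complexBetti.map (e s).hom 2 (complexBetti.map (fiberι f s) 2 (complexBetti.map E.ι 2 a))) ∧
          HasWeilDiscriminantCM (A s) (φ s) R e₀ p
            (complexBetti.map (e s).hom 2 (complexBetti.map (fiberι f s) 2 (complexBetti.map E.ι 2 a))) δ) ∧
        weilClassesField (A s) (φ s) (R.comp (X ^ 2)) (2 * p) ≤ algebraicClasses (A s).X p := by
  obtain ⟨A₀, η₀, h₀, hcm, hW, hpol, hros, hdisc, hHC, halg⟩ :=
    exists_cmMember_hodgeConjectureFor_of_exists_isNondegenerate K hK hb₀ hsep he hRm hRdeg hR hirr hroots haev hdegQ hnd hp δ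
  refine ⟨A₀, η₀, h₀, ⟨hcm, hW, hpol, hros, hdisc, hHC, halg⟩, ?_⟩
  intro 𝒳 S f hf hB Φ hΦ E a ha ha0 A e φ hK' hP U hUQ t hUt hU0 s₀ hdim u v n n' hn hn' hvu huv hu hv hH₀ s
  exact weilClassesField_le_algebraicClasses_and_componentDataPolarized_member_of_lefschetzB hf hB Φ hΦ E ha ha0 A e φ hK' hP U hUQ hUt
    hU0 hW hros hdisc halg hdim u v hn hn' hvu huv hu hv hH₀ s

/-- **THE TARGET-CONSUMED TWIN (∃ anchor ∀ pencils; no `B⋆`).** Same anchor; for every compact `E`-pencil as above (WITHOUT `B⋆`, and with the one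
intertwining `u ≫ η₀ = φ_{s₀} ≫ u` only), GRANTED `WeilClassesComponentCM R e₀ p δ`, all of `W_E(A_s, φ_s) ⊗ ℂ` is algebraic at EVERY member (§4). With
`exists_componentAnchor_forall_pencil_componentDataPolarized` this closes the square on every anchored pencil: `B⋆` of the ONE total space ⟹ [`W_E` of
every member algebraic] ⟸ the cell's typed target, both at literal instances of the target's binders. Neither hypothesis is claimed.
[cite: Deligne1982HodgeCycles, §4 (4.4), p. 30 (1), Prop. 4.1, Lemma 4.6 and §5 (c) pp. 38–39] [cite: Pohlmann1968, Thm. 1]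
[cite: MoonenZarhin1998WeilClasses, §1 (dim_F W_F = 1; «all or nothing»)] [cite: Andre2026, §4.4.4] -/
theorem exists_componentAnchor_forall_pencil_of_weilClassesComponentCM (hK : 2 < Module.finrank ℚ K)
    {b₀ : 𝓞 K} (hb₀ : IsCMField.complexConj K (b₀ : K) = -(b₀ : K))
    (hsep : Function.Injective fun σ : K →+* ℂ => σ (b₀ : K))
    {R : Polynomial ℤ} {e₀ : ℕ} (he : Module.finrank ℚ K = 2 * e₀) (hRm : R.Monic) (hRdeg : R.natDegree = e₀)
    (hR : R.comp (X ^ 2) = minpoly ℤ b₀) (hirr : Irreducible (cmPolyQ R))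
    (hroots : ∀ s : ℂ, Polynomial.eval₂ (Int.castRingHom ℂ) s R = 0 → s.im = 0 ∧ s.re < 0)
    (haev : Polynomial.aeval (b₀ : K) (cmPolyQ R) = 0) (hdegQ : (cmPolyQ R).natDegree = Module.finrank ℚ K)
    [Fact (Irreducible (realPolyQ R))] (hnd : ∃ Ψ : CMType K, IsNondegenerate Ψ) {p : ℕ} (hp : 0 < p)
    (δ : cmNormResidueGroup R) (hcell : WeilClassesComponentCM R e₀ p δ) :
    ∃ (A₀ : AbelianVariety ℂ) (η₀ : A₀ ⟶ A₀) (h₀ : complexBetti A₀.X 2),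
      (IsOfCMType A₀ ∧ IsWeilTypeCM A₀ η₀ R e₀ p ∧ IsPolarizationClass A₀.dim A₀.X h₀ ∧ RosatiCompatible A₀ η₀ h₀ ∧
        HasWeilDiscriminantCM A₀ η₀ R e₀ p h₀ δ ∧ HodgeConjectureFor A₀.dim A₀.X ∧
        weilClassesField A₀ η₀ (R.comp (X ^ 2)) (2 * p) ≤ algebraicClasses A₀.X p) ∧
      ∀ {𝒳 S : SchemeOver ℂ} {f : 𝒳 ⟶ S} (_hf : IsCompactAbelianPencil f (2 * p * e₀))
        (Φ : 𝒳 ⟶ 𝒳) (_hΦ : Φ ≫ f = f) (E : ProjectiveEmbedding 𝒳) (a : complexBetti (projectiveSpace E.n ℂ) 2)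
        (_ha : IsRationalClass a) (_ha0 : a ≠ 0)
        (A : ComplexPoints S → AbelianVariety ℂ) (e : ∀ s, (A s).X ≅ fiberOver f s) (φ : ∀ s, A s ⟶ A s)
        (_hK : ∀ s, ∃ Φs : fiberOver f s ⟶ fiberOver f s,
          Φs ≫ fiberι f s = fiberι f s ≫ Φ ∧ (e s).hom ≫ Φs = (φ s).hom.hom.hom ≫ (e s).hom)
        (_hP : ∀ s, Polynomial.eval₂ (Int.castRingHom (CategoryTheory.End (A s))) ((φ s : CategoryTheory.End (A s)))
          (R.comp (X ^ 2)) = 0)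
        (U : complexBetti 𝒳 (2 * p)) (_hUQ : IsRationalClass U) {t : ComplexPoints S}
        (_hUt : complexBetti.map (e t).hom (2 * p) (complexBetti.map (fiberι f t) (2 * p) U) ∈
          weilClassesField (A t) (φ t) (R.comp (X ^ 2)) (2 * p))
        (_hU0 : complexBetti.map (fiberι f t) (2 * p) U ≠ 0)
        {s₀ : ComplexPoints S} (_hdim : (A s₀).dim = A₀.dim) (u : A s₀ ⟶ A₀) (v : A₀ ⟶ A s₀) {n n' : ℕ} (_hn : 0 < n) (_hn' : 0 < n')
        (_hvu : v ≫ u = n • 𝟙 A₀) (_huv : u ≫ v = n' • 𝟙 (A s₀)) (_hu : u ≫ η₀ = φ s₀ ≫ u)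
        (_hH₀ : complexBetti.map (e s₀).hom 2 (complexBetti.map (fiberι f s₀) 2 (complexBetti.map E.ι 2 a)) =
          complexBetti.map u.hom.hom.hom 2 h₀)
        (s : ComplexPoints S),
        weilClassesField (A s) (φ s) (R.comp (X ^ 2)) (2 * p) ≤ algebraicClasses (A s).X p := by
  obtain ⟨A₀, η₀, h₀, hcm, hW, hpol, hros, hdisc, hHC, halg⟩ :=
    exists_cmMember_hodgeConjectureFor_of_exists_isNondegenerate K hK hb₀ hsep he hRm hRdeg hR hirr hroots haev hdegQ hnd hp δ
  refine ⟨A₀, η₀, h₀, ⟨hcm, hW, hpol, hros, hdisc, hHC, halg⟩, ?_⟩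
  intro 𝒳 S f hf Φ hΦ E a ha ha0 A e φ hK' hP U hUQ t hUt hU0 s₀ hdim u v n n' hn hn' hvu huv hu hH₀ s
  exact weilClassesField_le_algebraicClasses_forall_of_weilClassesComponentCM hf hcell Φ hΦ E ha ha0 A e φ hK' hP U hUQ hUt hU0 hW hros
    hdisc hdim u v hn hn' hvu huv hu hH₀ s

end Pencil

end Summit.HodgeConjecture.HodgeConjecture.Ring2.AbelianAll

end
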